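/-
Origin: expansion seat `planner-pub-hodgecm-pv06-g6-0`, handover #4 v2 (CLAIM 2026-08-18T13:36:41Z; doc-only v2 13:38:57Z per adv2-g36 precision, SUPERSEDES 42d936aa before handover, code residue identical ba98cda2; HANDOVER 2026-08-18T13:47:10Z) md5 333392cc6532847ddbd4017d8232f044 (608 l.); imports `Pv06g6.ArchCOrbitSmooth` (ONE rewrite -> `HodgeCM.PerL34.ArchCOrbitSmooth`, generic ^import Pv[0-9]+g[0-9]+\. rule; as-landed md5 d3b17e3b97c5d2edaec7e1fb79e4cd7b (`HOME/pub-hodgecm-pv06-g6/lean/Pv06g6/ArchCOrbitTheta.lean`, md5 333392cc, 608 lines);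
landed by the gen-8 packager in gate run 30 as `HodgeCM/PerL34/ArchCOrbitTheta.lean` (import ^import Pv06g6\.ArchCOrbitSmooth[ \t]*$→import HodgeCM.PerL34.ArchCOrbitSmooth ×1).
-/
/-
  HodgeCM/PerL34/ArchCOrbitTheta.lean   (origin: pub-hodgecm-pv06-g6, WIP module `Pv06g6.ArchCOrbitTheta`;
  session planner-pub-hodgecm-pv06-g6-0, DAG-NODE PROVER #06 gen 6; intended final place
  `HodgeCM/PerL34/ArchCOrbitTheta.lean`, module `HodgeCM.PerL34.ArchCOrbitTheta`; ONE import rewrite at intake: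
  `import Pv06g6.ArchCOrbitSmooth` ↦ `import HodgeCM.PerL34.ArchCOrbitSmooth` (this seat's RUN-30 row #2, b12b3920…).)

  # Lemma 4.1(c): the last analytic input on the AUTOMORPHIC side — the theta vector is a C¹ vector of R in L²

  NODE N29 (= [PerL] v5 Lemma 4.1(c), ll. 488–490 / 513–523; seam S4), continued from `ArchCOrbit.lean` /
  `ArchCOrbitSmooth.lean`.  KIND: KERNEL.  Nothing is cited, nothing is posited; complete proofs; standard axioms.

  THE POINT.  After `ArchCOrbitSmooth.lean` the weakest typed analytic input of L4.1(c) is the SCALAR derivative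
  `FockScalarBridge.hFpt`:  s ↦ 𝒯_{ω(e_j s)(φ⊗Φ_f)}(v)(p) has derivative 𝒯_{(X_jφ)⊗Φ_f}(v)(p) at s = 0, and the
  printed warrant offered so far is ω-SIDE ([SETUP D5′] `FockSmoothBridge.smooth`: Fock/Schwartz vectors are smooth
  vectors of ω in the FRÉCHET topology of 𝒮^κ, composed with the Schwartz-continuity `cont` of Φ ↦ 𝒯_Φ(v)(p)).
  This file records the OTHER classical warrant, which never mentions the topology of 𝒮^κ:
  * [NODE N21] invariance 𝒯_{ω(g)Φ}(R(g)v) = 𝒯_Φ(v) rearranges (KERNEL, `TΦc_omg_apply`) to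
        𝒯_{ω(g)Φ}(v)(p) = 𝒯_Φ(R(g)⁻¹v)(p) = ⟪R(g) θ_{Φ,p}, v⟫            (`pointValue_omg_eq_inner`)
    where θ_{Φ,p} ∈ L²([U(W)]) is the Riesz vector of the bounded functional v ↦ 𝒯_Φ(v)(p) (KERNEL:
    `rieszTheta` := `(InnerProductSpace.toDual ℂ H).symm (C4a.pointFunctional C P Φ p)`; in the model it is the complex
    conjugate of the theta kernel h ↦ θ_Φ(p,h)) and R is unitary (frozen AX9 `R_unitary`);
  * hence the ω-orbit scalar function IS an R-matrix coefficient, and `hFpt` follows (KERNEL, Mathlib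
    `HasDerivAt.inner`) from the R-SIDE statement
        [SETUP D5‴, THETA VECTOR C¹ UNDER R]  s ↦ R(e_j s) θ_{φ⊗Φ_f,p} has derivative θ_{(X_jφ)⊗Φ_f,p} at s = 0 IN L²,
    i.e. the theta kernel of φ⊗Φ_f, as an L² function on [U(W)], is a C¹ vector of the right regular representation
    along e_j, with derivative the theta kernel of (X_jφ)⊗Φ_f — the familiar "Φ ↦ θ_Φ is equivariant for the
    infinitesimal action at the real places; theta functions are smooth" of the theta-correspondence literature, in
    the L² sense only (no Schwartz topology, no Fréchet space, no operator norm).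
  WHERE [D5‴] SITS (all KERNEL, §0b/§1): the operator-norm input [SETUP D5] `FockOrbitBridge.hF` implies it
  (`hasDerivAt_rieszTheta_of_hF`, `FockThetaBridge.ofOrbit`: the Riesz map (L²)* → L² is a real-linear isometry); the
  ω-side [SETUP D5′] `FockSmoothBridge.smooth` TOGETHER WITH the operator-norm continuity of Φ ↦ 𝒯_Φ (tex l. 517, the
  operator form of [SETUP D4]; pv11 `continuous_TΦc` on the end state) implies it (`hasDerivAt_rieszTheta_of_tendsto_slope`,
  `FockThetaBridge.ofSmooth`); and it implies the scalar `hFpt` (`FockThetaBridge.toScalarBridge`), which remains the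
  weakest typed input (`FockScalarBridge`, RUN-30 row #2).  [D5‴] alone does not give back [D5′] or `hF` (strong L²
  derivative of ONE vector vs operator-norm / Fréchet statements).  A discharger may pick whichever side its model
  computes: the ω-side needs the Fréchet topology of 𝒮^κ — print warrant per referee O14-R (GAPS l. 9152): Poulsen 1972
  (J. Funct. Anal. 9) Prop. 1.2 + Thm. 1.2, p. 93; (D_∞(μ|Mp), Goodman topology) = (𝒮, Schwartz topology) by Folland
  1989 p. 165 (dμ(𝒥) = πi(D²+X²), (4.47)) + Reed–Simon I, App. to V.3 Lemmas 1–2 / Thm. V.13 (pp. 141–143) + Folland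
  Thm. (4.45); (4.45)/(4.49) for the VALUE dω(X_j); independently GAPS pv12g8-1 (Poulsen Ex. 5.1 p. 111, Corwin–Greenleaf
  Cor. 4.1.2 / App. A.1) — the R-side needs term-by-term differentiation of the theta series in the group variable with
  L² (or sup-norm) control on [U(W)], whose published inputs are THE SAME TWO (𝒮-continuity of Φ ↦ Θ_Φ + the 𝒮-orbit
  derivative; referee adv2-g36 13:37:21Z): [D5‴] is a second typed DOOR into N29, not an independent print warrant.

  CONTENTS.  §0 `rieszTheta`, `inner_rieszTheta`, `rieszTheta_eq_of_inner`, `inner_R_inv_right`, `pointValue_omg_eq_inner`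
  (N21 ⇒ 𝒯_{ω(g)Φ}(v)(p) = ⟪R(g)θ_{Φ,p}, v⟫), `hasDerivAt_inner_const`, `hasDerivAt_pointValue_of_thetaC1` ([D5‴] ⇒ `hFpt`),
  `hasDerivAt_matrixCoeff_of_thetaC1`, `rieszTheta_omg` (N21 as equivariance θ_{ω(g)Φ,p} = R(g)θ_{Φ,p}); §0b `toDualSymmR`,
  `hasDerivAt_toDual_symm`, `rieszTheta_eq`, `hasDerivAt_rieszTheta_of_hF` ([D5] ⇒ [D5‴]),
  `hasDerivAt_clm_comp_of_tendsto_slope_zero_vec` (vector-valued chain rule on a topological module, Mathlib only),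
  `pointFunctionalCLM`, `hasDerivAt_pointFunctional_of_slope_opNorm` ([D5′] + op-norm [D4] ⇒ `hF`),
  `hasDerivAt_rieszTheta_of_tendsto_slope` ([D5′] + op-norm [D4] ⇒ [D5‴]).  §1 records `FockThetaBridge C D P`
  (= `FockScalarBridge` with `hFpt` replaced by `thetaC1`), `FockThetaBridge.toScalarBridge`, `toOrbitCore`, `H_occ`,
  `ofOrbit`, `ofSmooth`; printed-places sibling `PrintedThetaSide` with `toThetaBridge`, `toScalarSide`, `H_occ`.
  §2 model level `Open_occ_of_fockThetaBridges`, `N29_occ_of_fockThetaBridges`.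
  LATTICE OF S4 INPUTS (kernel maps in the tree / this seat's files; all end in `OccLeaf` / `Open_occ`):
      FockOrbitBridge ─ofOrbit→ FockThetaBridge ←ofSmooth─ (FockSmoothBridge + op-norm continuity of Φ ↦ 𝒯_Φ)
      FockSmoothBridge ─toScalarBridge→ FockScalarBridge ←toScalarBridge─ FockThetaBridge ;  FockScalarBridge ─toOrbitCore→ OrbitCore.
  LABELS: [NODE N21] `invariance`; [NODE N28] `gen`/`φ₀_eigen` (kernel, pv12); [SETUP D4] linearity/continuity/density/
  `omg_ins`/`ιT`; [SETUP D5] `XR`, `e`, `ladder_span`; [SETUP D5‴] `thetaC1` (R-side, L²); [DEFINITIONAL]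
  `wOccurs_of_eigenvector`.  NAMING: `rieszTheta` (pv02-g5's `ArchAWeil.thetaVec` is a different object).
  ABSOLUTE RULE kept (nothing cited enters Lean; the labels name the warrant a discharger must quote).
-/
import Summits.HodgeConjecture.HodgeCM.PerL34.ArchCOrbitSmooth_2
import Mathlib.Analysis.InnerProductSpace.Calculus
import Mathlib.Analysis.InnerProductSpace.Dual
import Mathlib.Analysis.Calculus.Deriv.Linear

set_option autoImplicit false

noncomputable section

open scoped Topology
open Filter

namespace HodgeCM
namespace PerL34
namespace ArchC

open HodgeCM.Prior.Perl34File HodgeCM.Prior.Perl34File.Perl34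

/-! ## §0  The theta vector and the R-side derivative -/

section Theta

variable {H HG CG G SK SigIdx SigIdxG : Type*}
variable [NormedAddCommGroup H] [InnerProductSpace ℂ H] [CompleteSpace H]
variable [NormedAddCommGroup HG] [InnerProductSpace ℂ HG] [CompleteSpace HG]
variable [NormedAddCommGroup CG] [NormedSpace ℂ CG]
variable [Group G] [TopologicalSpace G] [TopologicalSpace SK]
variable {C : IsolationCore H HG CG G SK SigIdx SigIdxG} {P : C4a.PointedCore C}

local notation "⟪" x ", " y "⟫" => @inner ℂ _ _ x y

/-- **The theta vector** θ_{Φ,p} ∈ H = L²([U(W)]): the Riesz representative of the bounded linear functional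
v ↦ 𝒯_Φ(v)(p) (frozen `C4a.pointFunctional`; in the model, the complex conjugate of the theta kernel h ↦ θ_Φ(p,h)).
KERNEL (Mathlib `InnerProductSpace.toDual`). -/
def rieszTheta (C : IsolationCore H HG CG G SK SigIdx SigIdxG) (P : C4a.PointedCore C) (p : P.Pt) (Φ : SK) : H :=
  (InnerProductSpace.toDual ℂ H).symm (C4a.pointFunctional C P Φ p)

/-- Defining property of the theta vector: ⟪θ_{Φ,p}, v⟫ = 𝒯_Φ(v)(p). -/
theorem inner_rieszTheta (p : P.Pt) (Φ : SK) (v : H) : ⟪rieszTheta C P p Φ, v⟫ = P.evalPt p (C.TΦc Φ v) := by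
  rw [rieszTheta, InnerProductSpace.toDual_symm_apply]
  rfl

/-- The theta vector is determined by its defining property. -/
theorem rieszTheta_eq_of_inner (p : P.Pt) (Φ : SK) (θ : H) (hθ : ∀ v : H, ⟪θ, v⟫ = P.evalPt p (C.TΦc Φ v)) :
    rieszTheta C P p Φ = θ := by
  refine ext_inner_right ℂ fun v => ?_
  rw [inner_rieszTheta, hθ]

/-- Unitarity (frozen AX9), rearranged: ⟪u, R(g)⁻¹v⟫ = ⟪R(g)u, v⟫. -/
theorem inner_R_inv_right (g : G) (u v : H) : ⟪u, C.R g⁻¹ v⟫ = ⟪C.R g u, v⟫ := by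
  have h := C.inner_R_inv g⁻¹ u v
  rw [inv_inv] at h
  exact h.symm

/-- **[NODE N21] ⇒ the ω-orbit scalar function is an R-matrix coefficient of the theta vector**:
𝒯_{ω(g)Φ}(v)(p) = 𝒯_Φ(R(g)⁻¹v)(p) = ⟪R(g) θ_{Φ,p}, v⟫ (invariance, `R` a unitary homomorphism).  KERNEL. -/
theorem pointValue_omg_eq_inner
    (invariance : ∀ (h : G) (Φ : SK) (v : H), C.TΦc (C.omg h Φ) (C.R h v) = C.TΦc Φ v)
    (g : G) (Φ : SK) (p : P.Pt) (v : H) :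
    P.evalPt p (C.TΦc (C.omg g Φ) v) = ⟪C.R g (rieszTheta C P p Φ), v⟫ := by
  rw [TΦc_omg_apply invariance, ← inner_rieszTheta, inner_R_inv_right]

omit [CompleteSpace H] in
/-- Calculus (Mathlib `HasDerivAt.inner`): the derivative of s ↦ ⟪γ(s), v⟫ is ⟪γ′, v⟫. -/
theorem hasDerivAt_inner_const {γ : ℝ → H} {γ' : H} {s₀ : ℝ} (hγ : HasDerivAt γ γ' s₀) (v : H) :
    HasDerivAt (fun s => ⟪γ s, v⟫) ⟪γ', v⟫ s₀ := by
  have h := hγ.inner ℂ (hasDerivAt_const s₀ v)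
  simpa using h

/-- **[SETUP D5‴] ⇒ the scalar derivative `hFpt`** (KERNEL).  If the theta vector θ_{Φ,p} is a C¹ vector of R along
the curve e with derivative θ_{Ψ,p} (in the norm of H = L²), then for EVERY v the scalar function s ↦ 𝒯_{ω(e s)Φ}(v)(p)
has derivative 𝒯_Ψ(v)(p) at s = 0 — by [NODE N21] (`pointValue_omg_eq_inner`) that function is s ↦ ⟪R(e s)θ_{Φ,p}, v⟫. -/
theorem hasDerivAt_pointValue_of_thetaC1
    (invariance : ∀ (h : G) (Φ : SK) (v : H), C.TΦc (C.omg h Φ) (C.R h v) = C.TΦc Φ v)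
    {Φ Ψ : SK} {p : P.Pt} (e : ℝ → G)
    (hθ : HasDerivAt (fun s : ℝ => C.R (e s) (rieszTheta C P p Φ)) (rieszTheta C P p Ψ) 0) (v : H) :
    HasDerivAt (fun s : ℝ => P.evalPt p (C.TΦc (C.omg (e s) Φ) v)) (P.evalPt p (C.TΦc Ψ v)) 0 := by
  have hfun : (fun s : ℝ => P.evalPt p (C.TΦc (C.omg (e s) Φ) v)) =
      fun s : ℝ => ⟪C.R (e s) (rieszTheta C P p Φ), v⟫ :=
    funext fun s => pointValue_omg_eq_inner invariance (e s) Φ p v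
  rw [hfun, ← inner_rieszTheta (C := C) (P := P) p Ψ v]
  exact hasDerivAt_inner_const hθ v

/-- The hypothesis of `hasDerivAt_pointValue_of_thetaC1` in matrix-coefficient form: [D5‴] says exactly that every
matrix coefficient s ↦ ⟪R(e s)θ_{Φ,p}, v⟫ is differentiable at 0 with derivative ⟪θ_{Ψ,p}, v⟫, uniformly enough to be a
norm derivative; the scalar consequence needs no uniformity. -/
theorem hasDerivAt_matrixCoeff_of_thetaC1 {Φ Ψ : SK} {p : P.Pt} (e : ℝ → G)
    (hθ : HasDerivAt (fun s : ℝ => C.R (e s) (rieszTheta C P p Φ)) (rieszTheta C P p Ψ) 0) (v : H) :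
    HasDerivAt (fun s : ℝ => ⟪C.R (e s) (rieszTheta C P p Φ), v⟫) (P.evalPt p (C.TΦc Ψ v)) 0 := by
  rw [← inner_rieszTheta (C := C) (P := P) p Ψ v]
  exact hasDerivAt_inner_const hθ v

/-- **[NODE N21] as EQUIVARIANCE OF THE THETA VECTOR**: θ_{ω(g)Φ,p} = R(g) θ_{Φ,p} (KERNEL; in the model: the theta
kernel of ω(g)Φ is the right g-translate of the theta kernel of Φ). -/
theorem rieszTheta_omg
    (invariance : ∀ (h : G) (Φ : SK) (v : H), C.TΦc (C.omg h Φ) (C.R h v) = C.TΦc Φ v)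
    (g : G) (p : P.Pt) (Φ : SK) : rieszTheta C P p (C.omg g Φ) = C.R g (rieszTheta C P p Φ) :=
  ext_inner_right ℂ fun v => by rw [inner_rieszTheta, pointValue_omg_eq_inner invariance]

/-! ### §0b  The theta vector from the operator-norm inputs ([D5] `hF`, [D5′] `smooth` + operator-norm [D4]) -/

variable (H) in
/-- The Riesz anti-isomorphism (L²)* → L², `(InnerProductSpace.toDual ℂ H).symm`, as a continuous ℝ-LINEAR map (it is
conjugate-linear over ℂ; derivatives along real curves only see the ℝ-structure).  KERNEL (Mathlib). -/
def toDualSymmR : StrongDual ℂ H →L[ℝ] H :=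
  { toFun := fun ℓ => (InnerProductSpace.toDual ℂ H).symm ℓ
    map_add' := fun x y => map_add _ x y
    map_smul' := fun r ℓ => by
      simp only [RingHom.id_apply]
      rw [RCLike.real_smul_eq_coe_smul (K := ℂ) r ℓ, LinearIsometryEquiv.map_smulₛₗ]
      rw [RCLike.real_smul_eq_coe_smul (K := ℂ) r]
      congr 1
      exact Complex.conj_ofReal r
    cont := (InnerProductSpace.toDual ℂ H).symm.continuous }

omit [CompleteSpace HG] [TopologicalSpace G] [TopologicalSpace SK] in
/-- (Ported verbatim from the HodgeCMPerL package; no docstring in the source.) -/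
theorem toDualSymmR_apply (ℓ : StrongDual ℂ H) : toDualSymmR H ℓ = (InnerProductSpace.toDual ℂ H).symm ℓ := rfl

omit [CompleteSpace HG] [TopologicalSpace G] [TopologicalSpace SK] in
/-- A curve of bounded functionals differentiable in OPERATOR NORM has a differentiable curve of Riesz vectors. -/
theorem hasDerivAt_toDual_symm {L : ℝ → StrongDual ℂ H} {L' : StrongDual ℂ H} {s₀ : ℝ} (h : HasDerivAt L L' s₀) :
    HasDerivAt (fun s => (InnerProductSpace.toDual ℂ H).symm (L s)) ((InnerProductSpace.toDual ℂ H).symm L') s₀ :=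
  ((toDualSymmR H).hasFDerivAt).comp_hasDerivAt s₀ h

/-- The theta vector is the Riesz vector of the frozen point functional (definitional). -/
theorem rieszTheta_eq (p : P.Pt) (Φ : SK) :
    rieszTheta C P p Φ = (InnerProductSpace.toDual ℂ H).symm (C4a.pointFunctional C P Φ p) := rfl

/-- **[SETUP D5] (operator norm, `FockOrbitBridge.hF`) ⇒ [SETUP D5‴]** (KERNEL): if s ↦ (v ↦ 𝒯_{ω(e s)Φ}(v)(p)) has
derivative v ↦ 𝒯_Ψ(v)(p) at 0 in operator norm on (L²)*, then s ↦ R(e s) θ_{Φ,p} has derivative θ_{Ψ,p} at 0 in L²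
(by [NODE N21] `rieszTheta_omg` the latter curve is s ↦ θ_{ω(e s)Φ,p}, the Riesz image of the former). -/
theorem hasDerivAt_rieszTheta_of_hF
    (invariance : ∀ (h : G) (Φ : SK) (v : H), C.TΦc (C.omg h Φ) (C.R h v) = C.TΦc Φ v)
    {Φ Ψ : SK} {p : P.Pt} (e : ℝ → G)
    (hF : HasDerivAt (fun s : ℝ => C4a.pointFunctional C P (C.omg (e s) Φ) p) (C4a.pointFunctional C P Ψ p) 0) :
    HasDerivAt (fun s : ℝ => C.R (e s) (rieszTheta C P p Φ)) (rieszTheta C P p Ψ) 0 := by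
  have hfun : (fun s : ℝ => C.R (e s) (rieszTheta C P p Φ)) =
      fun s : ℝ => (InnerProductSpace.toDual ℂ H).symm (C4a.pointFunctional C P (C.omg (e s) Φ) p) :=
    funext fun s => by rw [← rieszTheta_omg invariance]; rfl
  rw [hfun]
  exact hasDerivAt_toDual_symm hF

omit [CompleteSpace HG] [TopologicalSpace G] [TopologicalSpace SK] in
/-- **Chain rule through a continuous linear map on a topological vector space, vector-valued** (the `E`-valued form
of `hasDerivAt_clm_comp_of_tendsto_slope_zero`, `ArchCOrbitSmooth` §0): if the difference quotients
s⁻¹ • (γ s − γ 0) of a curve `γ` in a topological ℂ-module `S` converge to `γ'` as s → 0, s ≠ 0, then for every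
continuous linear `T : S →L[ℂ] E` into a normed space the curve `T ∘ γ` has derivative `T γ'` at 0. -/
theorem hasDerivAt_clm_comp_of_tendsto_slope_zero_vec {S : Type*} [TopologicalSpace S] [AddCommGroup S]
    [Module ℂ S] {E : Type*} [NormedAddCommGroup E] [NormedSpace ℂ E]
    (T : S →L[ℂ] E) {γ : ℝ → S} {γ' : S}
    (h : Tendsto (fun s : ℝ => ((s : ℝ) : ℂ)⁻¹ • (γ s - γ 0)) (𝓝[≠] 0) (𝓝 γ')) :
    HasDerivAt (fun s => T (γ s)) (T γ') 0 := by
  rw [hasDerivAt_iff_tendsto_slope]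
  have h2 : Tendsto (fun s : ℝ => T (((s : ℝ) : ℂ)⁻¹ • (γ s - γ 0))) (𝓝[≠] 0) (𝓝 (T γ')) :=
    (T.continuous.tendsto γ').comp h
  refine h2.congr' (Eventually.of_forall fun s => ?_)
  show T (((s : ℝ) : ℂ)⁻¹ • (γ s - γ 0)) = slope (fun s => T (γ s)) 0 s
  rw [slope_def_module, sub_zero, map_smul, map_sub, ← Complex.ofReal_inv, Complex.coe_smul]

/-- The frozen point functional Φ ↦ (v ↦ 𝒯_Φ(v)(p)) as a CONTINUOUS LINEAR map 𝒮^κ → (L²)*, from [SETUP D4] linearity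
and the operator-norm continuity `hTc` of Φ ↦ 𝒯_Φ (tex l. 517 "continuity of Φ ↦ 𝒯_Φ", operator form; pv11
`continuous_TΦc` on the end state).  KERNEL. -/
def pointFunctionalCLM [AddCommGroup SK] [Module ℂ SK]
    (TΦc_add : ∀ Φ Ψ : SK, C.TΦc (Φ + Ψ) = C.TΦc Φ + C.TΦc Ψ)
    (TΦc_smul : ∀ (c : ℂ) (Φ : SK), C.TΦc (c • Φ) = c • C.TΦc Φ)
    (hTc : Continuous fun Φ : SK => C.TΦc Φ) (p : P.Pt) : SK →L[ℂ] StrongDual ℂ H :=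
  { toFun := fun Φ => C4a.pointFunctional C P Φ p
    map_add' := fun Φ Ψ => by
      show (P.evalPt p).comp (C.TΦc (Φ + Ψ)) = (P.evalPt p).comp (C.TΦc Φ) + (P.evalPt p).comp (C.TΦc Ψ)
      rw [TΦc_add, ContinuousLinearMap.comp_add]
    map_smul' := fun c Φ => by
      show (P.evalPt p).comp (C.TΦc (c • Φ)) = c • (P.evalPt p).comp (C.TΦc Φ)
      rw [TΦc_smul, ContinuousLinearMap.comp_smul]
    cont := continuous_const.clm_comp hTc }

/-- (Ported verbatim from the HodgeCMPerL package; no docstring in the source.) -/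
theorem pointFunctionalCLM_apply [AddCommGroup SK] [Module ℂ SK]
    (TΦc_add : ∀ Φ Ψ : SK, C.TΦc (Φ + Ψ) = C.TΦc Φ + C.TΦc Ψ)
    (TΦc_smul : ∀ (c : ℂ) (Φ : SK), C.TΦc (c • Φ) = c • C.TΦc Φ)
    (hTc : Continuous fun Φ : SK => C.TΦc Φ) (p : P.Pt) (Φ : SK) :
    pointFunctionalCLM TΦc_add TΦc_smul hTc p Φ = C4a.pointFunctional C P Φ p := rfl

/-- [SETUP D5′] `smooth` + operator-norm [D4] ⇒ the operator-norm derivative `hF` (KERNEL; the same implication as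
pv11-g9's `LinSmoothSide.toLinOrbit`, proved here independently through `pointFunctionalCLM`). -/
theorem hasDerivAt_pointFunctional_of_slope_opNorm [AddCommGroup SK] [Module ℂ SK]
    (TΦc_add : ∀ Φ Ψ : SK, C.TΦc (Φ + Ψ) = C.TΦc Φ + C.TΦc Ψ)
    (TΦc_smul : ∀ (c : ℂ) (Φ : SK), C.TΦc (c • Φ) = c • C.TΦc Φ)
    (hTc : Continuous fun Φ : SK => C.TΦc Φ) {γ : ℝ → SK} {γ' : SK}
    (h : Tendsto (fun s : ℝ => ((s : ℝ) : ℂ)⁻¹ • (γ s - γ 0)) (𝓝[≠] 0) (𝓝 γ')) (p : P.Pt) :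
    HasDerivAt (fun s : ℝ => C4a.pointFunctional C P (γ s) p) (C4a.pointFunctional C P γ' p) 0 :=
  hasDerivAt_clm_comp_of_tendsto_slope_zero_vec (pointFunctionalCLM TΦc_add TΦc_smul hTc p) h

/-- **[SETUP D5′] + operator-norm [D4] ⇒ [SETUP D5‴]** (KERNEL). -/
theorem hasDerivAt_rieszTheta_of_tendsto_slope [AddCommGroup SK] [Module ℂ SK]
    (TΦc_add : ∀ Φ Ψ : SK, C.TΦc (Φ + Ψ) = C.TΦc Φ + C.TΦc Ψ)
    (TΦc_smul : ∀ (c : ℂ) (Φ : SK), C.TΦc (c • Φ) = c • C.TΦc Φ)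
    (hTc : Continuous fun Φ : SK => C.TΦc Φ)
    (invariance : ∀ (h : G) (Φ : SK) (v : H), C.TΦc (C.omg h Φ) (C.R h v) = C.TΦc Φ v)
    {Φ Ψ : SK} {p : P.Pt} (e : ℝ → G)
    (h : Tendsto (fun s : ℝ => ((s : ℝ) : ℂ)⁻¹ • (C.omg (e s) Φ - C.omg (e 0) Φ)) (𝓝[≠] 0) (𝓝 Ψ)) :
    HasDerivAt (fun s : ℝ => C.R (e s) (rieszTheta C P p Φ)) (rieszTheta C P p Ψ) 0 :=
  hasDerivAt_rieszTheta_of_hF invariance e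
    (hasDerivAt_pointFunctional_of_slope_opNorm TΦc_add TΦc_smul hTc (γ := fun s => C.omg (e s) Φ) h p)

end Theta

/-! ## §1  The records: `FockThetaBridge`, `PrintedThetaSide` -/

section Bridge

open HodgeCM.PerL34.Fock HodgeCM.PerL34.Fock.PrintDict

variable {H HG CG G SK SigIdx SigIdxG : Type*}
variable [NormedAddCommGroup H] [InnerProductSpace ℂ H] [CompleteSpace H]
variable [NormedAddCommGroup HG] [InnerProductSpace ℂ HG] [CompleteSpace HG]
variable [NormedAddCommGroup CG] [NormedSpace ℂ CG]
variable [Group G] [TopologicalSpace G] [TopologicalSpace SK]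

/-- **Seam S4 bridge, THETA-VECTOR form** = `FockScalarBridge C D P` with the scalar derivative `hFpt` replaced by the
R-side statement `thetaC1` ([SETUP D5‴]: the theta vector of φ⊗Φ_f is a C¹ vector of R along e_j, in L², with
derivative the theta vector of (X_jφ)⊗Φ_f); every other field verbatim.  No topology of 𝒮^κ enters `thetaC1`
(the `[TopologicalSpace SK]` is used by `cont`/`dense` only, [SETUP D4]). -/
structure FockThetaBridge (C : IsolationCore H HG CG G SK SigIdx SigIdxG) (D : TorusData C)
    (P : C4a.PointedCore C) where
  /-- [SETUP D5 + NODE N28 local (kernel)] the real places with their κ_b-parts. -/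
  pl : Fock.FockPlaces
  /-- [SETUP D4] T(L₀⊗ℝ) ⊂ U(W)(𝔸) = `G`. -/
  ιT : pl.Tg →* G
  /-- [SETUP D4] the archimedean type w as a character of T(L₀⊗ℝ). -/
  w : pl.Tg →* ℂ
  /-- [SETUP D4] w is unitary. -/
  w_norm : ∀ t, ‖w t‖ = 1
  /-- [NODE N26 / DICTIONARY] the joint vacuum character IS w⁻¹. -/
  w_loc : ∀ t : pl.Tg, pl.χ t = (w t)⁻¹
  /-- [SETUP D4] the additive group structure of 𝒮^κ. -/
  [instSKacg : AddCommGroup SK]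
  /-- [SETUP D4] the ℂ-vector-space structure of 𝒮^κ. -/
  [instSKmod : Module ℂ SK]
  /-- [SETUP D4] Φ ↦ 𝒯_Φ is additive. -/
  TΦc_add : ∀ Φ Ψ : SK, C.TΦc (Φ + Ψ) = C.TΦc Φ + C.TΦc Ψ
  /-- [SETUP D4] Φ ↦ 𝒯_Φ is homogeneous. -/
  TΦc_smul : ∀ (c : ℂ) (Φ : SK), C.TΦc (c • Φ) = c • C.TΦc Φ
  /-- [SETUP D4] Φ ↦ 𝒯_Φ(v)(g) is continuous on 𝒮^κ (used ONLY for the density step `pure_detect`). -/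
  cont : ∀ (p : P.Pt) (v : H), Continuous fun Φ : SK => P.evalPt p (C.TΦc Φ v)
  /-- [SETUP D4] index of the fixed finite data Φ_f. -/
  FinIdx : Type
  /-- [SETUP D4] φ ↦ φ ⊗ Φ_f, linear. -/
  ins : FinIdx → pl.F →ₗ[ℂ] SK
  /-- [SETUP D4/D5] the pure tensors span a dense subspace of 𝒮^κ. -/
  dense : Dense (Submodule.span ℂ (Set.range fun q : FinIdx × pl.F => ins q.1 q.2) : Set SK)
  /-- [SETUP D4] ω(t)(φ ⊗ Φ_f) = (ω_∞(t)φ) ⊗ Φ_f. -/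
  omg_ins : ∀ (f : FinIdx) (t : pl.Tg) (φ : pl.F), C.omg (ιT t) (ins f φ) = ins f (pl.ωT t φ)
  /-- [NODE N21] 𝒯_{ω(h)Φ}(R(h)v) = 𝒯_Φ(v). -/
  invariance : ∀ (h : G) (Φ : SK) (v : H), C.TΦc (C.omg h Φ) (C.R h v) = C.TΦc Φ v
  /-- [SETUP D5] index of a family of real directions X_j ∈ 𝔲(W)(L₀⊗ℝ). -/
  ιR : Type
  /-- [SETUP D5] ω_∞(X_j) on 𝓕^κ_∞. -/
  XR : ιR → pl.F →ₗ[ℂ] pl.F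
  /-- [SETUP D4] the curves e_j : ℝ → U(W)(𝔸) (intended exp(sX_j); only behaviour at s → 0 is consumed). -/
  e : ιR → ℝ → G
  /-- [SETUP D5] ladder operators are complex combinations of the real directions. -/
  ladder_span : ∀ k : pl.ιX, pl.X k ∈ Submodule.span ℂ (Set.range XR)
  /-- [SETUP D5‴, THETA VECTOR C¹ UNDER R — a statement on the automorphic side: no topology of 𝒮^κ, no operator norm]
  for every point p, the theta vector θ_{φ⊗Φ_f,p} ∈ H = L²([U(W)]) (`rieszTheta`: the Riesz vector of v ↦ 𝒯_{φ⊗Φ_f}(v)(p),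
  i.e. the conjugate theta kernel h ↦ θ(p,h)) is a C¹ vector of the unitary representation R along e_j with derivative
  θ_{(X_jφ)⊗Φ_f,p}:  s ↦ R(e_j s) θ_{φ⊗Φ_f,p} has derivative θ_{(X_jφ)⊗Φ_f,p} at s = 0 in the norm of H.
  PRINT WARRANT a discharger must quote: EITHER the ω-side one — [D5′] (referee O14-R, GAPS l. 9152: Poulsen 1972
  Prop. 1.2 + Thm. 1.2 p. 93; Folland 1989 p. 165 + Reed–Simon I App. to V.3 / Thm. V.13 pp. 141–143 + Folland Thm.
  (4.45)) plus the operator-norm continuity of Φ ↦ 𝒯_Φ (tex l. 517), from which this clause FOLLOWS in the kernel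
  (`FockThetaBridge.ofSmooth`) — OR the automorphic-side form: smoothness of y ↦ Θ_Φ(p,y) on the compact [U(W)]
  (Weil n°39-type, Φ ∈ 𝒮) makes θ_{Φ,p} a C¹ vector of R in L² with SOME derivative, and IDENTIFYING that derivative
  with θ_{(X_jφ)⊗Φ_f,p} (R(X)θ_Φ = θ_{dω(X)Φ}) differentiates s ↦ Θ_{ω(e_j s)Φ} under the theta sum, hence uses the
  same two published inputs (𝒮-continuity of Φ ↦ Θ_Φ, tex l. 343, and the 𝒮-orbit derivative [D5′], O14-R): a second
  DOOR for a discharger, NOT a second independent print warrant (referee adv2-g36, STATUS 13:37:21Z).  This clause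
  gives `FockScalarBridge.hFpt` (`toScalarBridge`). -/
  thetaC1 : ∀ (j : ιR) (f : FinIdx) (φ : pl.F) (p : P.Pt),
    HasDerivAt (fun s : ℝ => C.R (e j s) (rieszTheta C P p (ins f φ))) (rieszTheta C P p (ins f (XR j φ))) 0
  /-- [DEFINITIONAL] the meaning of the bare frozen predicate `TorusData.wOccurs`. -/
  wOccurs_of_eigenvector : ∀ i : SigIdx,
    (∃ y ∈ C.hatσ i, y ≠ 0 ∧ ∀ t : pl.Tg, C.R (ιT t) y = w t • y) → D.wOccurs i

namespace FockThetaBridge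

variable {C : IsolationCore H HG CG G SK SigIdx SigIdxG} {D : TorusData C} {P : C4a.PointedCore C}

/-- **Theta bridge ⇒ scalar bridge** (KERNEL: `hFpt` from `thetaC1` and [NODE N21] by
`hasDerivAt_pointValue_of_thetaC1`). -/
def toScalarBridge (B : FockThetaBridge C D P) : FockScalarBridge C D P :=
  letI : AddCommGroup SK := B.instSKacg
  letI : Module ℂ SK := B.instSKmod
  { pl := B.pl
    ιT := B.ιT
    w := B.w
    w_norm := B.w_norm
    w_loc := B.w_loc
    instSKacg := B.instSKacg
    instSKmod := B.instSKmod
    TΦc_add := B.TΦc_add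
    TΦc_smul := B.TΦc_smul
    cont := B.cont
    FinIdx := B.FinIdx
    ins := B.ins
    dense := B.dense
    omg_ins := B.omg_ins
    invariance := B.invariance
    ιR := B.ιR
    XR := B.XR
    e := B.e
    ladder_span := B.ladder_span
    hFpt := fun j f φ p v =>
      hasDerivAt_pointValue_of_thetaC1 B.invariance (B.e j) (B.thetaC1 j f φ p) v
    wOccurs_of_eigenvector := B.wOccurs_of_eigenvector }

/-- (Ported verbatim from the HodgeCMPerL package; no docstring in the source.) -/
theorem toScalarBridge_pl (B : FockThetaBridge C D P) :
    B.toScalarBridge.pl = B.pl ∧ B.toScalarBridge.w = B.w := ⟨rfl, rfl⟩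

/-- The D7-free chart from the theta bridge. -/
def toOrbitCore (B : FockThetaBridge C D P) : OrbitCore C P := B.toScalarBridge.toOrbitCore

/-- (Ported verbatim from the HodgeCMPerL package; no docstring in the source.) -/
theorem toOrbitCore_eigen_iff (B : FockThetaBridge C D P) (i : SigIdx) :
    B.toOrbitCore.Eigen i ↔ ∃ y ∈ C.hatσ i, y ≠ 0 ∧ ∀ t : B.pl.Tg, C.R (B.ιT t) y = B.w t • y := Iff.rfl


-- port_pkg: scope closed for this part
end FockThetaBridge
end Bridge
end ArchC
end PerL34
end HodgeCM
end
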